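import Summits.BirchSwinnertonDyer.BirchSwinnertonDyer.Theorems.AdditiveKolyvaginRoadLevelSystems
import Summits.BirchSwinnertonDyer.BirchSwinnertonDyer.Theorems.KolyvaginRoadThreeMethod2LocalDictionaries
import Summits.BirchSwinnertonDyer.BirchSwinnertonDyer.Theorems.KolyvaginRoadThreeMethod2TransverseStrict
import HarnessLib

/-!
# Route `AdditiveKolyvaginRoad`, crux `KolyvaginPrimitiveAdditive` (item stmt-BirchSwinnertonDyer-20132):
# PER-PLACE DICTIONARIES between the tree's GLOBAL local-condition currency and the GENUINE localisation maps, general `p`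
# (cell `pub/bsd-wall`, lead prover `bsd-wall-akr-p1` g3; `--supports stmt-BirchSwinnertonDyer-20132`, helper;
# p-generic port of zhang3-p1's `…Method2LocalDictionaries.lean` + `…Method2TransverseStrict.lean`, `3 ↦ p`,
# ordinary ↦ TORIC, `transverseLocalKer ↦ transverseLocalKerP`)

WHY THIS FILE. S2-ENGINE of crux 20132 (skeleton v7) is W. Zhang's induction run by the tree's p-uniform engine over a
place-indexed apparatus `(Hv, loc, b, E, L, …)`; in the model `loc v := galoisCohomology.localization (E[p]) v 1` and
the canonical spaces are cut out by the tree's GLOBAL currencies `torsionLocalKer` ∕ `selmerLocalKer` ∕ `toricLocalKer`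
∕ `transverseLocalKerP`. This file is the per-place dictionary between the two, at a general prime `p`.

WHAT.
* `mem_torsionLocalKer_iff_localization_eq_zero_P` — strict vanishing = kernel of the genuine localisation
  (`hZero`); `ker_localization_eq_torsionLocalKer_P`;
* `mem_selmerLocalKer_iff_localization_mem_kummer_P` ∕ `…_inf_P` — Kummer = preimage of the genuine local Kummer
  condition `kummerLocalConditionAt` (`hKumFin` ∕ `hKumInf`);
* `mem_toricLocalKer_iff_localization_mem_map_P` — TORIC = preimage of its own image (`hOrd` with
  `Ord v := (toricLocalKer_v).map loc_v`; the kernel is toric);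
* `torsionLocalKer_le_transverseLocalKerP` — a class with ZERO localisation at `v` is transverse at `v` (proof =
  zhang3-p1's: the representing cocycle is a coboundary on a decomposition group, transported by conjugation);
  `mem_transverseLocalKerP_iff_localization_mem_map` (`hTr` with `Tr ℓ := (transverseLocalKerP).map loc`);
* `mem_eigenSubmoduleP_iff` — the eigenspace dictionary for `ker(τ − sgnP s)` (`hE`).

HONEST FRAMING: theorems only; 0 definitions, 0 named facts, 0 `sorry`; closes nothing.

References: [cite: WZhang2014, §5, §8.1] [cite: SilvermanAEC2009, X.§4, Cor. III.6.4(b)] [cite: McCallumLMS1991,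
§3 (3)] [cite: NeukirchANT1999, Ch. I §9 (9.1)] [cite: GrossLMS1991, §5 (5.1)].
-/

-- single-conjunct summit: `Summit.BirchSwinnertonDyer.BirchSwinnertonDyer.…` repeats the name by design
set_option linter.dupNamespace false

noncomputable section

open scoped Classical Pointwise

namespace Summit.BirchSwinnertonDyer.BirchSwinnertonDyer.Theorems.AdditiveKoly

open WeierstrassCurve NumberField IsDedekindDomain Field
  Literature.NumberTheory.EllipticCurves Literature.NumberTheory.EllipticCurves.ModularForms
  Literature.NumberTheory.GaloisRepresentations Module
open Summit.BirchSwinnertonDyer.Rank1Residual.X11b.Three.Koly.Method2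

variable (W : WeierstrassCurve ℚ) (K : Type) [Field K] [NumberField K] (p : ℕ)

/-- **The eigenspace dictionary**: membership in `ker(τ − sgnP s)` (as a `ZMod p`-subspace) is `τ x = sgnP s • x`.
The dictionary `hE` with `E s := toZModSubmodule p (ker(conjAct − sgnP s • id))`. [cite: GrossLMS1991, §5 (5.1)] -/
theorem mem_eigenSubmoduleP_iff (c : K ≃ₐ[ℚ] K) [Module (ZMod p) (Vp W K p)] (s : Bool) (x : Vp W K p) :
    x ∈ AddSubgroup.toZModSubmodule p (conjAct W c ((p ^ 1 : ℕ) : ℤ) - sgnP s • AddMonoidHom.id (Vp W K p)).ker ↔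
      conjAct W c ((p ^ 1 : ℕ) : ℤ) x = sgnP s • x := by
  rw [AddSubgroup.mem_toZModSubmodule, AddMonoidHom.mem_ker, AddMonoidHom.sub_apply, sub_eq_zero]
  rfl

/-- **Kummer = preimage of the genuine local Kummer condition**, finite place: `x ∈ selmerLocalKer_v ⟺ loc_v x ∈ 𝓛_v`
(`𝓛_v = kummerLocalConditionAt`, tree `comap_res_kummerLocalConditionAt`). The dictionary `hKumFin`.
[cite: SilvermanAEC2009, X.§4] -/
theorem mem_selmerLocalKer_iff_localization_mem_kummer_P (v : HeightOneSpectrum (𝓞 K)) (x : Vp W K p) :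
    x ∈ selmerLocalKer (W.baseChange K) (v.adicCompletion K) ((p ^ 1 : ℕ) : ℤ) ↔
      galoisCohomology.localization ((W.baseChange K).torsionGaloisModule ((p ^ 1 : ℕ) : ℤ)) (Sum.inr v) 1 x ∈
        (W.baseChange K).kummerLocalConditionAt ((p ^ 1 : ℕ) : ℤ) (v.adicCompletion K) := by
  exact (SetLike.ext_iff.mp
    ((W.baseChange K).comap_res_kummerLocalConditionAt ((p ^ 1 : ℕ) : ℤ) (v.adicCompletion K)) x).symm

/-- **Kummer = preimage of the genuine local Kummer condition**, infinite place. The dictionary `hKumInf`.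
[cite: SilvermanAEC2009, X.§4] -/
theorem mem_selmerLocalKer_iff_localization_mem_kummer_inf_P (w : InfinitePlace K) (x : Vp W K p) :
    x ∈ selmerLocalKer (W.baseChange K) w.Completion ((p ^ 1 : ℕ) : ℤ) ↔
      galoisCohomology.localization ((W.baseChange K).torsionGaloisModule ((p ^ 1 : ℕ) : ℤ)) (Sum.inl w) 1 x ∈
        (W.baseChange K).kummerLocalConditionAt ((p ^ 1 : ℕ) : ℤ) w.Completion := by
  exact (SetLike.ext_iff.mp
    ((W.baseChange K).comap_res_kummerLocalConditionAt ((p ^ 1 : ℕ) : ℤ) w.Completion) x).symm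

variable [W.IsElliptic] [Fact p.Prime]

/-- **Strict vanishing = kernel of the genuine localisation** at a finite place `v`:
`x ∈ torsionLocalKer_v ⟺ loc_v x = 0` in `H¹(K_v, E[p])` (tree `mem_torsionLocalKer_iff_res_eq_zero`). The dictionary
`hZero`. [cite: McCallumLMS1991, §3 (3)] [cite: SilvermanAEC2009, Cor. III.6.4(b)] -/
theorem mem_torsionLocalKer_iff_localization_eq_zero_P (v : HeightOneSpectrum (𝓞 K)) (x : Vp W K p) :
    x ∈ (W.baseChange K).torsionLocalKer (v.adicCompletion K) ((p ^ 1 : ℕ) : ℤ) ↔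
      galoisCohomology.localization ((W.baseChange K).torsionGaloisModule ((p ^ 1 : ℕ) : ℤ)) (Sum.inr v) 1 x = 0 := by
  haveI : CharZero (v.adicCompletion K) :=
    charZero_of_injective_algebraMap (algebraMap K (v.adicCompletion K)).injective
  have hp : p.Prime := Fact.out
  exact mem_torsionLocalKer_iff_res_eq_zero (W.baseChange K) (v.adicCompletion K) (k := p ^ 1)
    (pow_ne_zero 1 hp.ne_zero) x

/-- The kernel of the genuine localisation at a finite place IS `torsionLocalKer`. [folklore] -/
theorem ker_localization_eq_torsionLocalKer_P (v : HeightOneSpectrum (𝓞 K)) :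
    (galoisCohomology.localization ((W.baseChange K).torsionGaloisModule ((p ^ 1 : ℕ) : ℤ)) (Sum.inr v) 1).ker =
      (W.baseChange K).torsionLocalKer (v.adicCompletion K) ((p ^ 1 : ℕ) : ℤ) := by
  ext x
  exact (mem_torsionLocalKer_iff_localization_eq_zero_P W K p v x).symm

/-- **Toric = preimage of its own image** under the genuine localisation at a finite place (it contains the
kernel). The dictionary `hOrd` with `Ord v := (toricLocalKer_v).map loc_v`. [cite: BertoliniDarmon2005, §2.3] -/
theorem mem_toricLocalKer_iff_localization_mem_map_P (v : HeightOneSpectrum (𝓞 K)) (x : Vp W K p) :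
    x ∈ toricLocalKer (W.baseChange K) (v.adicCompletion K) ((p ^ 1 : ℕ) : ℤ) ↔
      galoisCohomology.localization ((W.baseChange K).torsionGaloisModule ((p ^ 1 : ℕ) : ℤ)) (Sum.inr v) 1 x ∈
        (toricLocalKer (W.baseChange K) (v.adicCompletion K) ((p ^ 1 : ℕ) : ℤ)).map
          (galoisCohomology.localization ((W.baseChange K).torsionGaloisModule ((p ^ 1 : ℕ) : ℤ)) (Sum.inr v) 1) :=
  -- `torsionLocalKer ≤ toricLocalKer`: the zero local class is represented by the zero cocycle (akr-p1 g0's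
  -- `torsionLocalKer_le_toricLocalKer`, inlined to keep this module out of the route file's import cone)
  have hle : (W.baseChange K).torsionLocalKer (v.adicCompletion K) ((p ^ 1 : ℕ) : ℤ) ≤
      toricLocalKer (W.baseChange K) (v.adicCompletion K) ((p ^ 1 : ℕ) : ℤ) := by
    intro y hy
    change (W.baseChange K).torsionLocMap (v.adicCompletion K) _ y = 0 at hy
    change y ∈ AddSubgroup.comap _ _
    rw [AddSubgroup.mem_comap, hy]
    exact AddSubgroup.zero_mem _
  mem_iff_apply_mem_map_of_ker_le _ ((ker_localization_eq_torsionLocalKer_P W K p v).le.trans hle) x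

/-- **A class with ZERO localisation at `v` is transverse at `v`** (for every `ℓ` and every complex embedding `ι`):
`torsionLocalKer_v ≤ transverseLocalKerP ι ℓ v`. Proof = zhang3-p1's `torsionLocalKer_le_transverseLocalKer` with
`3 ↦ p`: the representing cocycle is a coboundary `d ↦ dP − P` on the decomposition group of one prime `𝔓₀ ∣ v`; every
other `𝔓 ∣ v` is a conjugate `σ𝔓₀`, and `[x, σ d₀ σ⁻¹] = σ[x, d₀] = 0` for `d₀` fixing `E[p]`.
[cite: WZhang2014, §8.1] [cite: NeukirchANT1999, Ch. I §9 (9.1)] -/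
theorem torsionLocalKer_le_transverseLocalKerP (ι : K →+* ℂ) (ℓ : ℕ) (v : HeightOneSpectrum (𝓞 K)) :
    (W.baseChange K).torsionLocalKer (v.adicCompletion K) ((p ^ 1 : ℕ) : ℤ) ≤ transverseLocalKerP W K p ι ℓ v := by
  have hp : p.Prime := Fact.out
  intro x hx 𝔓 h𝔓 d hdD _ hdT
  obtain ⟨𝔐, h𝔐⟩ := v.localPrimesAbove_nonempty
  have h𝔓₀ : v.primeBelow (closureEmb (K := K) (v.adicCompletion K)) 𝔐 ∈ v.primesAbove :=
    HeightOneSpectrum.primeBelow_mem_primesAbove h𝔐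
  -- the cocycle of `x` is a coboundary on `D_{𝔓₀}`
  have hx' : oneCocycleClass _ (reprCocycle (W.baseChange K) ((p ^ 1 : ℕ) : ℤ) x) ∈
      (W.baseChange K).torsionLocalKer (v.adicCompletion K) ((p ^ 1 : ℕ) : ℤ) := by
    rw [oneCocycleClass_reprCocycle]; exact hx
  obtain ⟨P, hP⟩ := (LocalFrob.oneCocycleClass_mem_torsionLocalKer_iff (W.baseChange K) (n := p ^ 1)
    (pow_ne_zero 1 hp.ne_zero) h𝔐 (reprCocycle (W.baseChange K) ((p ^ 1 : ℕ) : ℤ) x)).mp hx'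
  -- transitivity: `σ • 𝔓₀ = 𝔓`, so `d = σ d₀ σ⁻¹` with `d₀ ∈ D_{𝔓₀}`
  obtain ⟨σ, hσ⟩ := HeightOneSpectrum.exists_smul_eq_of_mem_primesAbove_holds h𝔓₀ h𝔓
  have hd' : d ∈ MulAut.conj σ •
      (v.primeBelow (closureEmb (K := K) (v.adicCompletion K)) 𝔐).decompositionSubgroup (absoluteGaloisGroup K) := by
    rw [← Ideal.decompositionSubgroup_smul, hσ]; exact hdD
  obtain ⟨d₀, hd₀, rfl⟩ := (Subgroup.mem_smul_pointwise_iff_exists _ _ _).mp hd'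
  have hconj : (MulAut.conj σ • d₀ : absoluteGaloisGroup K) = σ * d₀ * σ⁻¹ := rfl
  -- `d₀` fixes `E[p]` (the fixing subgroup is normal)
  have hd₀T : d₀ ∈ torsionFixing (W.baseChange K) ((p ^ 1 : ℕ) : ℤ) := by
    have h := (torsionFixing_normal (W.baseChange K) ((p ^ 1 : ℕ) : ℤ)).conj_mem _ hdT σ⁻¹
    rw [hconj, inv_inv] at h
    simpa [mul_assoc] using h
  rw [hconj, h1Eval_conj (W.baseChange K) _ x σ hd₀T]
  -- `[x, d₀] = d₀ P − P = 0`
  have h0 : h1Eval (W.baseChange K) ((p ^ 1 : ℕ) : ℤ) x d₀ = 0 := by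
    change (reprCocycle (W.baseChange K) ((p ^ 1 : ℕ) : ℤ) x).1 d₀ = 0
    rw [hP d₀ hd₀, smul_eq_of_mem_torsionFixing (W.baseChange K) _ hd₀T, sub_self]
  rw [h0, smul_zero]

/-- **Transverse = preimage of its own image** under the genuine localisation at `v` (it contains the kernel, by
`torsionLocalKer_le_transverseLocalKerP`). The dictionary `hTr` with `Tr := (transverseLocalKerP …).map loc_v`.
[cite: WZhang2014, §8.1 (H¹_tr)] -/
theorem mem_transverseLocalKerP_iff_localization_mem_map (ι : K →+* ℂ) (ℓ : ℕ) (v : HeightOneSpectrum (𝓞 K))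
    (x : Vp W K p) :
    x ∈ transverseLocalKerP W K p ι ℓ v ↔
      galoisCohomology.localization ((W.baseChange K).torsionGaloisModule ((p ^ 1 : ℕ) : ℤ)) (Sum.inr v) 1 x ∈
        (transverseLocalKerP W K p ι ℓ v).map
          (galoisCohomology.localization ((W.baseChange K).torsionGaloisModule ((p ^ 1 : ℕ) : ℤ)) (Sum.inr v) 1) :=
  mem_iff_apply_mem_map_of_ker_le _
    ((ker_localization_eq_torsionLocalKer_P W K p v).le.trans (torsionLocalKer_le_transverseLocalKerP W K p ι ℓ v)) x

end Summit.BirchSwinnertonDyer.BirchSwinnertonDyer.Theorems.AdditiveKoly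

end
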